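import Mathlib.NumberTheory.Cyclotomic.Basic
import Literature.NumberTheory.EllipticCurves.Wuthrich2014.ReducibleDivisibilityCyclotomicThree
import Literature.NumberTheory.EllipticCurves.Wuthrich2014.ReducibleMultiplicativeDivisibility
import Literature.NumberTheory.EllipticCurves.PAdicLFunctionMinusMult
import HarnessLib

/-!
# Wuthrich 2014, Thm. 16 at a SPLIT MULTIPLICATIVE `p = 3`, read over `K = ℚ(ζ₃)`:
# `T · char_Λ X(E/ℚ(ζ_{3^∞})) ∋ u · L₃(E, ω⁰, T) · L₃(E, ω¹, T)` (named fact; the split twin of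
# `thm16_charIdeal_dvd_nonsplitMultiplicative_cyclotomicThree`)

Source: C. Wuthrich, *On the integrality of modular symbols and Kato's Euler system for elliptic
curves*, Doc. Math. 19 (2014) 381–402 [Wuthrich2014], **Theorem 16** (p. 397): "Let `E/ℚ` be an
elliptic curve and let `p > 2` be a prime. Suppose that `E` has semi-stable reduction at `p` and that
`E[p]` is reducible as a `G_ℚ`-module. Then `char_Λ X(E)` divides the ideal generated by `L_p(E)`. **If
the reduction of `E` is split multiplicative at `p`, then `I · char_Λ X(E)` divides the ideal generated
by `L_p(E)`, where `I` is the kernel of the homomorphism `Λ → ℤ_p` that sends all elements of [the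
group to `1`]**"; §5 (p. 397): `X(E)` = the dual of `lim_n Sel(E/ℚ(ζ_{p^n}))`, "a finitely generated
`Λ`-module … `Λ`-torsion … The same conclusion holds in general in our situation; see [Kobayashi 2006]
for the split multiplicative case"; §1 Thm. 3 (p. 383): "We formulate it here for the full cyclotomic
`ℤ_p^×`-extension"; §3 (p. 390): `Λ = ℤ_p⟦G⟧`, `M = ⊕ M_i`; §3.2 (p. 394): at a split multiplicative
prime "Theorem 4.1 in [Kobayashi 2006] proves that the Coleman map … is injective and has image with
finite index inside `I`"; Cor. 18 (p. 398): `L_p(E) ∈ Λ` for semi-stable `p > 2`. Torsion over the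
abelian base `ℚ(ζ₃)` also: Greenberg, LNM 1716 Thm. 1.5 (Kato–Rohrlich), PDF p. 61.

ONE NAMED FACT (`def … : Prop`, nothing asserted, D-0014/D-0026): the SPLIT multiplicative clause of
Theorem 16 at `p = 3`, transcribed over `K = ℚ(ζ₃)` EXACTLY as the non-split sibling
`thm16_charIdeal_dvd_nonsplitMultiplicative_cyclotomicThree` (p217659) and the good-ordinary sibling
`charIdeal_dvd_padicLFunction_cyclotomicThree` (p206900; referee R94.2, flag
`Wu14-Thm16-p3-branch-split`). The `K`-reading of the factor `I`: `I ⊂ Λ(G) = Λ(Γ)e₊ ⊕ Λ(Γ)e₋` is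
the augmentation ideal (kernel of `Λ(G) → ℤ_p`), so `e₋ ∈ I` (the augmentation map kills
`e₋ = (1 − [−1])/2`) and `e₊ I = (T)`: the printed `L_p(E) ∈ I · char X(E)` says
`L₃(E,ω⁰,T) ∈ T · char(e₊X)` (the exceptional zero of the EVEN branch) and `L₃(E,ω¹,T) ∈ char(e₋X)`
(no zero on the odd branch: `ω` is ramified at `3`), hence — characteristic ideals being multiplicative
over `X = e₊X ⊕ e₋X` — `T · char_{Λ(Γ)} X(E/K_∞) ∋ L₃(E,ω⁰,T)·L₃(E,ω¹,T)`, i.e.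
`ι(T·g) = u ϖϖ'·L⁺·L⁻` for some `g ∈ char_{Λ(Γ)} X(E/K_∞)` — literally the shape of the tree's
ℚ_∞-transcription of the same clause (`thm16_charIdeal_dvd_multiplicative_of_reducible`, clause (3):
`ι(T · g) = ϖ · L`). Local type at `3`: `L_p(E)` is the ONE-term Mazur–Tate–Teitelbaum measure
(`ε(p) = 0`, allowable root `α = a_p = +1`; MTT §I.10), whose even branch is THE function `L` with
`IsSplitMultPAdicLFunctionOf f 3 L` (tree `PAdicBSD`, the currency of `corollary19_splitMultiplicative` /
`thm16_charIdeal_dvd_multiplicative_of_reducible` / `greenberg_stevens`) and whose odd branch is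
`padicLFunctionMinusBranchMult f 1 1` (tree `PAdicLFunctionMinusMult`, `α = 1`). Periods as in the
siblings (`ϖ·Ω_E = Ω⁺_f`, `ϖ'·|Ω⁻(E)| = Ω⁻_f`; units collected in `u ∈ ℤ₃ˣ`).

Hypotheses transcribed: `E = V` globally minimal over `ℚ`, SPLIT multiplicative at `3`
(`HasSplitMultiplicativeReductionAtPrime 3`), `E[3]` reducible, `K` cyclotomic `{3}` over `ℚ`, `V'` any
`K`-model of `E_K`, `κ` cyclotomic with topological generator `γ`, `χ₃(γ)·ζ = 4`, `f` the newform of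
`E`, `D` a dual datum of `Sel_{3^∞}(E/K_∞)`, the periods `ϖ, ϖ'`, `L` the even branch. Conclusion:
`X(E/K_∞)` is `Λ`-torsion and `ι(T · g) = u ϖϖ' · L · L⁻₃(f,1,ω¹,T)` for some `g ∈ char_{Λ(Γ)} X(E/K_∞)`,
`u ∈ ℤ₃ˣ`. Proposed flag: `Wu14-Thm16-p3-branch-split` (+ the `I`-reading above, part of the same
bookkeeping). What is NOT here: `p ≠ 3`, any proof.
-- TODO(general form): Thm. 16 for every odd `p` over `K = ℚ(μ_p)`.

Consumer: the BSD rank-≤1 residual cell (`b2b-bsdres`, additive-p4, line V16): with Greenberg's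
Euler characteristic at a split multiplicative prime over `K`
(`Greenberg1999.thm41Analogue_charValue_rankZero_split_baseChange`), the Greenberg–Stevens derivative
formula (`greenberg_stevens`) and Milne's identity this bounds `#Ш(E/ℚ)[3^∞]·#Ш(E^{(−3)}/ℚ)[3^∞]` for
the ADDITIVE twist of a curve with SPLIT multiplicative reduction at `3` and reducible `E[3]` — the
(M)-rows of class X3 at `p = 3` with split twist. HONEST FRAMING: no label changes; nothing here is
"finishing BSD".
-/

set_option autoImplicit false

noncomputable section

open scoped Classical MatrixGroups ModularForm

open CongruenceSubgroup WeierstrassCurve Literature.NumberTheory.EllipticCurves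
  Literature.NumberTheory.EllipticCurves.ModularForms
  Literature.NumberTheory.GaloisRepresentations

namespace Literature.NumberTheory.EllipticCurves.Wuthrich2014

/-- **Wuthrich 2014, Theorem 16 at a SPLIT MULTIPLICATIVE `p = 3`, `E[3]` reducible, read over
`K = ℚ(ζ₃)`: `T · char_{Λ(Γ)} X(E/ℚ(ζ_{3^∞})) ∋ u · L₃(E, ω⁰, T) · L₃(E, ω¹, T)`.** As printed (Doc. Math.
19 (2014), Thm. 16, p. 397): "Let `E/ℚ` be an elliptic curve and let `p > 2` be a prime. Suppose that
`E` has semi-stable reduction at `p` and that `E[p]` is reducible as a `G_ℚ`-module. Then `char_Λ X(E)`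
divides the ideal generated by `L_p(E)`. If the reduction of `E` is split multiplicative at `p`, then
`I · char_Λ X(E)` divides the ideal generated by `L_p(E)`" — `Λ = ℤ_p⟦Gal(ℚ(ζ_{p^∞})/ℚ)⟧` (§1 Thm. 3,
§3 p. 390), `I` its augmentation ideal, `X(E)`
the dual of `lim_n Sel(E/ℚ(ζ_{p^n}))` (§5 p. 397, "a finitely generated `Λ`-module … `Λ`-torsion … in
general in our situation; see [Kobayashi] for the split multiplicative case"; Greenberg LNM 1716
Thm. 1.5 for the abelian base `ℚ(ζ₃)`), `L_p(E) ∈ Λ` (Cor. 18) the Néron-normalised ONE-term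
Mazur–Tate–Teitelbaum measure (`ε(p) = 0`, `α = a_p = +1`). For `p = 3`: `ℚ(ζ_{3^∞}) = K_∞`,
`K = ℚ(ζ₃)`, `X(E) = X(E/K_∞)` = the tree's Iwasawa module of any `K`-model `V'` of `E_K` (`κ`
cyclotomic, `χ₃(γ)·ζ = 4`); `Λ(G) = Λ(Γ)e₊ ⊕ Λ(Γ)e₋` with `e₊I = (T)`, `e₋I = e₋Λ` turns the printed
`L_p(E) ∈ I·char X(E)` into `L₃(E,ω⁰,T) ∈ T·char(e₊X)`, `L₃(E,ω¹,T) ∈ char(e₋X)`, hence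
`T·char_{Λ(Γ)} X(E/K_∞) ∋ L₃(E,ω⁰,T)·L₃(E,ω¹,T)` (the reading of the accepted siblings p206900 /
p217659, flag `Wu14-Thm16-p3-branch-split`, plus the `I`-bookkeeping): even branch = THE `L` with
`IsSplitMultPAdicLFunctionOf f 3 L` (exceptional zero `L(0) = 0`), odd branch =
`padicLFunctionMinusBranchMult f 1 1`, periods `ϖ·Ω_E = Ω⁺_f`, `ϖ'·|Ω⁻(E)| = Ω⁻_f`, units in
`u ∈ ℤ₃ˣ`. Hypotheses: `V` globally minimal, SPLIT multiplicative at `3`, `V[3]` reducible, `K`, `V'`,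
`κ`, `γ`, `ζ`, `f`, `D`, `ϖ`, `ϖ'`, `L` as displayed. Conclusion:
`D.IsTorsion ∧ ∃ g ∈ char, ∃ u, ι(X · g) = C(u ϖ ϖ') · (L · L⁻₃(f,1,ω¹,T))` (the shape of clause (3)
of `thm16_charIdeal_dvd_multiplicative_of_reducible`). Named fact; nothing asserted.
**RETIRED as a separate named fact (cell `b2b-bsdres`, referee ruling R120.2, 2026-08-20, endorsing
lit C175 (ii); deprecate-and-add):** this `p = 3` special case is a KERNEL CONSEQUENCE of the odd-`p`
reading `Wuthrich2014.thm16_charIdeal_dvd_splitMultiplicative_cyclotomicPrime`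
(`ReducibleMultiplicativeDivisibilityCyclotomicPrime.lean`) — derivation
`Wuthrich2014.thm16_charIdeal_dvd_splitMultiplicative_cyclotomicThree_of_cyclotomicPrime`
(`ReducibleMultiplicativeDivisibilityCyclotomicThreeOfPrime.lean`, p238245); the cell's class-level
consumers were re-based on the odd-`p` readings in
`Summits/BirchSwinnertonDyer/Rank1Residual/Additive/SemistableTwistRankZeroThreeClassOfPrime.lean`
(p238590). New consumers take the general fact; existing consumers migrate to the `…OfPrime` form
when next touched; this `def` is kept verbatim only until no module references it, then removed.
[cite: Wuthrich2014, Thm. 16 and §5 (p. 397), §1 Thm. 3 (p. 383), §3 (p. 390), §3.2 (p. 394), Cor. 18 (p. 398)]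
[cite: GreenbergLNM1716, Thm. 1.5 (PDF p. 61)] [cite: MazurTateTeitelbaum1986Invent, §I.10, §I.13] -/
def thm16_charIdeal_dvd_splitMultiplicative_cyclotomicThree : Prop :=
  ∀ (V : WeierstrassCurve ℚ) [V.IsElliptic] [V.IsGloballyMinimal]
    (K : Type) [Field K] [NumberField K] [IsCyclotomicExtension {3} ℚ K]
    (V' : WeierstrassCurve K) [V'.IsElliptic]
    {κ : ZpExtension K 3} {γ : Field.absoluteGaloisGroup K} {N : ℕ} [NeZero N]
    {f : CuspForm (Gamma0 N) 2},
    V.HasSplitMultiplicativeReductionAtPrime 3 → ¬ V.HasIrreducibleModPGaloisRep 3 →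
    (∃ C : VariableChange K, C • V.baseChange K = V') →
    κ.IsCyclotomic → κ.IsTopGenerator γ →
    (∃ ζ : ℤ_[3]ˣ, IsOfFinOrder ζ ∧
      ((GaloisRep.cyclotomicCharacter K 3 γ * ζ : ℤ_[3]ˣ) : ℤ_[3]) =
        (cyclotomicGenerator 3 : ℤ_[3])) →
    IsNewformOf V f →
    ∀ (D : V'.SelmerDualData κ γ) (ϖ ϖ' : ℚ),
      (ϖ : ℝ) * V.realPeriodRat = plusPeriod f →
      (ϖ' : ℝ) * V.imaginaryPeriodRat = minusPeriod f →
    ∀ (L : PowerSeries ℚ_[3]), IsSplitMultPAdicLFunctionOf f 3 L →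
      D.IsTorsion ∧
      ∃ g ∈ D.charIdeal, ∃ u : ℤ_[3]ˣ,
        iwasawaToPowerSeries 3 (PowerSeries.X * g) =
          PowerSeries.C (((u : ℤ_[3]) : ℚ_[3]) * (ϖ : ℚ_[3]) * (ϖ' : ℚ_[3])) *
            (L * padicLFunctionMinusBranchMult f (1 : ℚ_[3]) 1)

end Literature.NumberTheory.EllipticCurves.Wuthrich2014

end
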